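import Literature.Computability.Cryptography.NTRU
import Literature.Computability.Cryptography.CenteredBinomialMLWE
import Literature.Computability.Cryptography.LWEProofs
import Literature.Algebra.EuclideanLattices.DiscreteGaussianInt
import HarnessLib

/-!
# The Falcon key distribution and its decision-NTRU assumption

Topic `Computability/Cryptography`. Falcon's key generation (Fouque et al., Falcon specification v1.2,
§2.6 eq. (2.12) and Algorithm 5 `NTRUGen`, lines 1–8; Algorithm 4 line 9): over `R_q = ℤ_q[x]/(x^n+1)`,
`q = 12289`, `n ∈ {512, 1024}`, "each coefficient of `f` and `g` is sampled from the discrete Gaussian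
`D_{ℤ,σ_{f,g}}` with `σ_{f,g} = 1.17·√(q/2n)`" (eq. (2.12); `D_{ℤ,σ,μ}(x) ∝ exp(−|x−μ|²/2σ²)`, §3.x
p. 24), "if `NTT(f)` contains 0 as a coefficient then restart ▷ Check that `f` is invertible mod `q`"
(Alg. 5 lines 7–8), and the public key is "`h ← g f⁻¹ mod q`" (Alg. 4 line 9). The pseudorandomness of
`h` is the (one-sample, normal-form) NTRU learning problem of `NTRU.lean` (Peikert 2016, Def. 4.4.4) at
this key law — the assumption an `h`-vs-uniform census row on Falcon-shaped instances probes (no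
uniformity THEOREM covers it: Stehlé–Steinfeld's regime needs `σ ≳ √q·poly(n)`, cell file
REDUCTIONS.md §R5).

## Contents

* `RingLWE.gaussianCoeffRq b q σ` — an element of `R_q` with i.i.d. `D_{ℤ,σ}` coordinates in the basis
  `b` (standard deviation `σ`, i.e. the tree's `discreteGaussianInt` with GPV parameter `s = σ√(2π)`);
  `RingLWE.one_mem_support_gaussianCoeffRq` (full support ⇒ the conditioning on units is legitimate).
* `FALCON.q = 12289`, `FALCON.sigmaFG n = 1.17·√(q/2n)`, `FALCON.coeffLaw k` (the law of `f` and of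
  `g` over `𝓞(ℚ(ζ_{2^k})) ⧸ (q)` in the power basis, `n = 2^{k−1}`; Falcon-512: `k = 10`,
  Falcon-1024: `k = 11`), `FALCON.publicKeyLaw k`, `FALCON.keyDistinguishingAdvantage k D`.

## Faithfulness notes

* MODELLED: Alg. 5 lines 1–8 (coefficient Gaussians, rejection of non-invertible `f`) and `h = g f⁻¹`.
  NOT MODELLED: the further rejections of Alg. 5 lines 9–14 (restart if the Gram–Schmidt norm
  `γ = ‖B‖_GS > 1.17√q`, eq. (2.11); restart if `NTRUSolve` fails). The recorded `publicKeyLaw` is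
  therefore the law of `h` conditioned on invertibility only; Falcon's actual key law is its further
  conditioning on those two events (both of non-negligible but not overwhelming probability). A
  distinguisher row must say which law its instances were drawn from.
* Gaussian convention: Falcon's `σ` is a standard deviation; `discreteGaussianInt s c` uses
  `ρ_s(x) = exp(−π x²/s²)`, so `s = σ·√(2π)` gives `exp(−x²/2σ²)`.
* The tail-cut / table-based sampler of Falcon (Alg. 5 lines 3–4 comment, eq. (3.29)) realises
  `D_{ℤ,σ_{f,g}}` up to a negligible statistical distance; the ideal law is recorded.

## References

* P.-A. Fouque et al., *Falcon: Fast-Fourier lattice-based compact signatures over NTRU*,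
  specification v1.2 (2020-10-01): §2.6 eqs. (2.10)–(2.12), Table 3.3, Algorithm 4 (Keygen) line 9,
  Algorithm 5 (NTRUGen) lines 1–14, p. 24 (`D_{ℤ,σ,μ}`). [FouqueEtAl2020FalconSpec]
* C. Peikert, *A decade of lattice cryptography* (2016), Def. 4.4.4 (NTRU learning problem; via
  `NTRU.lean`). [PeikertDecade2016]
* C. Gentry, C. Peikert, V. Vaikuntanathan, STOC 2008, §4.1 (`D_{ℤ,s,c}`; via
  `Literature.Algebra.EuclideanLattices.discreteGaussianInt`). [GentryPeikertVaikuntanathan2008]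
-/

noncomputable section

open scoped ENNReal NumberField
open NumberField Literature.Algebra.EuclideanLattices

namespace Literature.Computability.Cryptography

namespace RingLWE

variable {K : Type} [Field K] [NumberField K] {n : ℕ} (b : Module.Basis (Fin n) ℤ (𝓞 K))
  (q : ℕ) [NeZero q]

/-- An element of `R_q` whose `n` coordinates in the `ℤ`-basis `b` are i.i.d. discrete Gaussians
`D_{ℤ,σ}` of standard deviation parameter `σ` centred at `0` (Falcon spec Alg. 5 lines 2–6: "for i
from 0 to n−1 do `f_i ← D_{ℤ,σ_{f,g},0}`"; realised with the tree's `discreteGaussianInt (σ√(2π)) 0`,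
see the Gaussian-convention note). [cite: FouqueEtAl2020FalconSpec, Algorithm 5 (NTRUGen) lines 1–6] -/
def gaussianCoeffRq (σ : ℝ) : PMF (Rq K q) :=
  (LWE.iidPMF (discreteGaussianInt (σ * Real.sqrt (2 * Real.pi)) 0) n).map (ofIntCoords b q)

omit [NumberField K] [NeZero q] in
/-- For `σ > 0` the coefficient-Gaussian law gives positive mass to `1 ∈ R_q` (every coordinate vector,
in particular that of `1 ∈ 𝓞 K`, has positive mass: `discreteGaussianInt_pos`, `iidPMF_apply_holds`).
[cite: FouqueEtAl2020FalconSpec, Algorithm 5 (NTRUGen) lines 1–8] -/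
theorem one_mem_support_gaussianCoeffRq {σ : ℝ} (hσ : 0 < σ) :
    (1 : Rq K q) ∈ (gaussianCoeffRq b q σ).support := by
  rw [gaussianCoeffRq, PMF.support_map]
  refine ⟨fun i => b.repr 1 i, ?_, ?_⟩
  · rw [PMF.mem_support_iff, LWE.iidPMF_apply_holds]
    exact Finset.prod_ne_zero_iff.2 fun i _ =>
      (discreteGaussianInt_pos (by positivity) 0 _).ne'
  · show Ideal.Quotient.mk _ (∑ i, b.repr 1 i • b i) = 1
    rw [b.sum_repr]
    exact map_one _

omit [NumberField K] [NeZero q] in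
/-- Hence some unit (namely `1`) lies in the support: the conditioning of `NTRU.normalFormSamples` on
invertible denominators is legitimate for this law. [cite: FouqueEtAl2020FalconSpec, Algorithm 5 (NTRUGen) lines 7–8] -/
theorem exists_isUnit_mem_support_gaussianCoeffRq {σ : ℝ} (hσ : 0 < σ) :
    ∃ f ∈ (gaussianCoeffRq b q σ).support, IsUnit f :=
  ⟨1, one_mem_support_gaussianCoeffRq b q hσ, isUnit_one⟩

end RingLWE

/-! ### The Falcon instance -/

namespace FALCON

/-- The Falcon modulus `q = 12289 = 12·1024 + 1` (Falcon spec eq. (2.10), Table 3.3).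
[cite: FouqueEtAl2020FalconSpec, §2.6 eq. (2.10)] -/
def q : ℕ := 12289

/-- `q ≠ 0`. [cite: FouqueEtAl2020FalconSpec, §2.6 eq. (2.10)] -/
instance : NeZero q := ⟨by decide⟩

/-- `q = 12·1024 + 1`. [cite: FouqueEtAl2020FalconSpec, §2.6 eq. (2.10)] -/
theorem q_eq : q = 12 * 1024 + 1 := by decide

/-- Falcon's key standard deviation `σ_{f,g} = 1.17·√(q/2n)` (Falcon spec eq. (2.12), Alg. 5 line 1:
"σ_{f,g} is chosen so that E[‖(f,g)‖] = 1.17√q"). [cite: FouqueEtAl2020FalconSpec, §2.6 eq. (2.12)] -/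
def sigmaFG (n : ℕ) : ℝ := 1.17 * Real.sqrt (q / (2 * n))

/-- `σ_{f,g} > 0` for `n ≥ 1`. [cite: FouqueEtAl2020FalconSpec, §2.6 eq. (2.12)] -/
theorem sigmaFG_pos {n : ℕ} (hn : 0 < n) : 0 < sigmaFG n := by
  unfold sigmaFG
  have hq : (0 : ℝ) < q := by norm_num [q]
  have h : (0 : ℝ) < q / (2 * n) := by positivity
  positivity

/-- The law of `f` (and, independently, of `g`) in Falcon with ring degree `n = 2^{k−1}`, over
`R_q = 𝓞(ℚ(ζ_{2^k})) ⧸ (12289) ≅ ℤ_q[x]/(x^n + 1)` in the power basis: coefficient-wise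
`D_{ℤ,σ_{f,g}}` (Alg. 5 lines 1–6). Falcon-512 is `k = 10`, Falcon-1024 is `k = 11`.
[cite: FouqueEtAl2020FalconSpec, Algorithm 5 (NTRUGen) lines 1–6 and Table 3.3] -/
def coeffLaw (k : ℕ) : PMF (RingLWE.Rq (CyclotomicField (2 ^ k) ℚ) q) :=
  RingLWE.gaussianCoeffRq (cyclotomicPowerBasis k).basis q (sigmaFG (2 ^ (k - 1)))

/-- The law of the Falcon public key `h = g·f⁻¹ mod q` with `f, g ← coeffLaw k` independent and `f`
conditioned on being invertible mod `q` (Alg. 5 lines 7–8 "Check that f is invertible mod q …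
restart"; Alg. 4 line 9), as the one-sample normal-form NTRU distribution `NTRU.normalFormSamples`.
Faithfulness note of the module docstring: the Gram–Schmidt-norm and `NTRUSolve` rejections (Alg. 5
lines 9–14) are NOT modelled. [cite: FouqueEtAl2020FalconSpec, Algorithm 4 line 9 and Algorithm 5 lines 1–8] -/
def publicKeyLaw (k : ℕ) : PMF (Fin 1 → RingLWE.Rq (CyclotomicField (2 ^ k) ℚ) q) :=
  NTRU.normalFormSamples (coeffLaw k)
    (RingLWE.exists_isUnit_mem_support_gaussianCoeffRq _ q (sigmaFG_pos (Nat.two_pow_pos (k - 1)))) 1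

/-- **Decision NTRU for Falcon keys**: the advantage of a (randomised) distinguisher `D` in telling a
Falcon public key `h` (law `publicKeyLaw k`) from a uniform element of `R_q`:
`|Pr[D(h) accepts] − Pr[D(u) accepts]|` — Peikert 2016, Def. 4.4.4 with one normal-form sample at the
Falcon key law (Falcon spec §2.5.1 "Key recovery"). [cite: FouqueEtAl2020FalconSpec, §2.5.1 and Algorithm 5] [cite: PeikertDecade2016, Def. 4.4.4] -/
def keyDistinguishingAdvantage (k : ℕ)
    (D : NTRU.Distinguisher (CyclotomicField (2 ^ k) ℚ) q 1) : ℝ :=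
  |(LWE.acceptProb D (publicKeyLaw k)).toReal -
    (LWE.acceptProb D (NTRU.uniformSamples (CyclotomicField (2 ^ k) ℚ) q 1)).toReal|

/-- The key-distinguishing advantage lies in `[0, 1]`. [cite: PeikertDecade2016, Def. 4.4.4] -/
theorem keyDistinguishingAdvantage_mem_Icc (k : ℕ)
    (D : NTRU.Distinguisher (CyclotomicField (2 ^ k) ℚ) q 1) :
    keyDistinguishingAdvantage k D ∈ Set.Icc (0 : ℝ) 1 := by
  refine ⟨abs_nonneg _, abs_sub_le_iff.2 ⟨?_, ?_⟩⟩
  · have h1 : (LWE.acceptProb D (publicKeyLaw k)).toReal ≤ 1 :=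
      ENNReal.toReal_le_of_le_ofReal zero_le_one (by simpa using LWE.acceptProb_le_one D _)
    linarith [ENNReal.toReal_nonneg
      (a := LWE.acceptProb D (NTRU.uniformSamples (CyclotomicField (2 ^ k) ℚ) q 1))]
  · have h2 : (LWE.acceptProb D (NTRU.uniformSamples (CyclotomicField (2 ^ k) ℚ) q 1)).toReal ≤ 1 :=
      ENNReal.toReal_le_of_le_ofReal zero_le_one (by simpa using LWE.acceptProb_le_one D _)
    linarith [ENNReal.toReal_nonneg (a := LWE.acceptProb D (publicKeyLaw k))]

end FALCON

end Literature.Computability.Cryptography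

end
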